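import Mathlib
import HarnessLib
import Summits.HubbardSuperconductivity.HubbardSuperconductivity.Theorems.KLProgrammeKLRegimeEngineV8E5WitnessLevels
import Summits.HubbardSuperconductivity.HubbardSuperconductivity.Theorems.KLProgrammeKLRegimeEngineV8E5WitnessStepL1

/-!
# Route `KLProgramme` — ENGINE child gen 8 (stmt-HubbardSuperconductivity-20437 `KLRegimeEngineV17F2`), SKELETON v2 class #3, PROVING side:
# the `∃ (C,u)` from L1 data · dressing smallness · ONE carrier law · ONE smallness line (the ASSEMBLY, part 5b)
# (cell gate-hubbard-kl, seat p5 g9; composes `…E5WitnessLevels` §7 with `…E5WitnessStepL1` §6)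

* §8 **`exists_e5Pkg2_of_stepDataLaw`** / **`e5ShareStep2_klE5Raise2_of_stepDataLaw`** — `exists_e5Pkg2_of_stepDataL1` with the vertex conjuncts of
  `h3` REPLACED by the carrier law of `klE5_vertexPackage_of_levelLaw` (shape of `LevelsUMixedAt` WITH the gain on every degree incl. the quartic, odd
  prescriptions `0`, table `C₀·Θ^p`, coupling `P.Klam·U`, level `n−2`, `m`-indexed by `m/2` to avoid `Fin (2p)` casts) + the smallness line
  `(κ₀² + 8·Cκ·e₀·8^{−(n−2)})·Θ·(Klam U)·8^{n−2} ≤ ½`; per step `n ≥ 3` the remaining inputs are L1 (`α`, `κ₀`, `α ≤ λ·Cα·ε⁻¹·16^n/e₀²`), the dressing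
  smallness, the law, that line; for `n ≤ 2` the trivial-family raw data (any `CA ≥ C₀²Θ⁵/64`).

Pure composition; no definitions, no named facts, nothing about the model's sizes is asserted; nothing asserts superconductivity.
-/

noncomputable section

namespace Summit.HubbardSuperconductivity.HubbardSuperconductivity.Theorems.KLRegimeSplit

set_option linter.dupNamespace false -- summit = problem name (single-conjunct summit), D-0017

open Real Finset Literature.MathematicalPhysics.QuantumLattice Literature.Probability.LatticeModels GrassmannAlgebra Matrix

/-! ## §8 The `∃ (C,u)` of record from: L1 data · dressing smallness · ONE carrier law · ONE smallness line (+ the first steps' trivial data) -/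

section Law

variable (P : SplitConsts) (R : RenConsts) {Cα Cδ C₀ Θ CA : ℝ}

open Literature.MathematicalPhysics.QuantumLattice.FermiRG
open Summit.HubbardSuperconductivity.HubbardSuperconductivity.Theorems.KLProgrammeLegKernels
open Summit.HubbardSuperconductivity.HubbardSuperconductivity.Theorems.KLRegimeWick
open Summit.HubbardSuperconductivity.HubbardSuperconductivity.Theorems.EngineV8
open Summit.HubbardSuperconductivity.HubbardSuperconductivity.Theorems.TwoPointAssembly
open Summit.HubbardSuperconductivity.HubbardSuperconductivity.Theorems.TorusFourierL2
open Summit.HubbardSuperconductivity.HubbardSuperconductivity.Theorems.DispersionFlow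

/-- **The class-#3 `∃ (C,u)` with the vertex package DERIVED from one carrier law.**  Inputs, per step `n ≥ 3` and for every candidate L2 constant
`Cκ > 0` (threshold chosen after it): the scaled line-`0` data `α, κ₀` with `α ≤ λ·Cα·ε⁻¹·16^n/e₀²` (L1), the dressing smallness (SM), ONE levelled-norm law
for the (R1′) carrier on the point-augmented thin family of level `n−2` in the shape of `LevelsUMixedAt` WITH the gain on every degree (table `C₀·Θ^p`,
`Θ ≥ 1`, coupling `P.Klam·U`; odd prescriptions `0`), and the smallness line `(κ₀² + 8·Cκ·e₀·8^{−(n−2)})·Θ·(Klam U)·8^{n−2} ≤ ½`; for `n ≤ 2` the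
trivial-family raw data (any `CA ≥ C₀²Θ⁵/64`).  Then `∃ e, IsE5Pkg2 e ∧ E5ShareStep2 P R e.1 e.2`. [cite: BenfattoGiulianiMastropietro2006, Lemma 2.5 (2.98)] -/
theorem exists_e5Pkg2_of_stepDataLaw (hP : P.WF) (hR : R.WF2) (hCα : 0 ≤ Cα) (hC₀ : 0 ≤ C₀) (hΘ : 1 ≤ Θ) (hCA : C₀ ^ 2 * Θ ^ 5 / 64 ≤ CA)
    (hKlam : 0 ≤ P.Klam)
    (h3 : ∀ Cκ : ℝ, 0 < Cκ → ∃ u : EngConsts → ℝ → ℝ, (∀ Q cc, 0 < u Q cc) ∧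
        ∀ G : GeoConsts, G.WF → ∀ Q : EngConsts, (klEngQ7 P R).IsRaiseOf Q →
        ∀ cc : ℝ, 0 < cc → cc ≤ klEngC₃6 P R →
        ∀ μ ∈ klWindowC, ∀ U : ℝ, 0 < U → U ≤ klEngU₀10 P R cc → U ≤ u Q cc →
        ∀ β : ℝ, klBetaMin ≤ β → β ≤ Real.exp (cc / U ^ 2) →
        ∀ (L M : ℕ) [NeZero L] [NeZero M], klEngL₄ P R β U ≤ L → klEngM₃ β U L ≤ M →
        ∀ n : ℕ, 1 ≤ n → n ≤ nScales β + 1 → IsKLRegime U cc (-(n : ℤ)) →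
        HistP klPredsV17F2 L M G P Q R β U μ 0 n →
        FrameOK R U (nScales β) μ (klFlowFrameU L M β U μ n) →
        (∀ j ≤ n, LevelsUExportMixedAt L M (klCU2 P R (klEngQ7 P R)) P β U μ j) →
        ∀ Λ ∈ Set.Icc (klScale klE0 n) (klScale klE0 (n - 1)), ∀ Qm : TorusSite 2 L,
        ∀ x y : TorusSite 2 L × MatsubaraIdx M, x.1 ∈ klBall L μ 0 → y.1 ∈ klBall L μ 0 →
        3 ≤ n →
        ∃ (α κ₀ : ℝ), 0 ≤ α ∧ 0 ≤ κ₀ ∧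
          (∀ X, ∑ Y, ‖((sectorSubMatrix L M β (bgmFatMultiplier L M klE0 β (nambuXiCT L μ (klFlowFrameU L M β U μ n)) (n - 2))).transpose *
            normalCovariance L M (fun ks => ((klScale klE0 (n - 1) - klScale klE0 n : ℝ) : ℂ) * klE5DerivLineSym L M β μ (klFlowFrameU L M β U μ n) (n - 1) (klE5Kappa L M β U μ (klFlowFrameU L M β U μ n) (n - 1)) Λ ks) *
            sectorSubMatrix L M β (bgmFatMultiplier L M klE0 β (nambuXiCT L μ (klFlowFrameU L M β U μ n)) (n - 2))) X Y‖ ≤ α) ∧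
          (∀ Y, ∑ X, ‖((sectorSubMatrix L M β (bgmFatMultiplier L M klE0 β (nambuXiCT L μ (klFlowFrameU L M β U μ n)) (n - 2))).transpose *
            normalCovariance L M (fun ks => ((klScale klE0 (n - 1) - klScale klE0 n : ℝ) : ℂ) * klE5DerivLineSym L M β μ (klFlowFrameU L M β U μ n) (n - 1) (klE5Kappa L M β U μ (klFlowFrameU L M β U μ n) (n - 1)) Λ ks) *
            sectorSubMatrix L M β (bgmFatMultiplier L M klE0 β (nambuXiCT L μ (klFlowFrameU L M β U μ n)) (n - 2))) X Y‖ ≤ α) ∧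
          (∀ Y : SpaceTimeIdx L M × SectorLeg (sectorCount (n - 2)), Y.2.2 = 0 →
            ‖sectorGramF L M β (bgmFatMultiplier L M klE0 β (nambuXiCT L μ (klFlowFrameU L M β U μ n)) (n - 2)) (fun ks => ((klScale klE0 (n - 1) - klScale klE0 n : ℝ) : ℂ) * klE5DerivLineSym L M β μ (klFlowFrameU L M β U μ n) (n - 1) (klE5Kappa L M β U μ (klFlowFrameU L M β U μ n) (n - 1)) Λ ks) Y‖ ≤ κ₀) ∧
          (∀ Y : SpaceTimeIdx L M × SectorLeg (sectorCount (n - 2)), Y.2.2 = 1 →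
            ‖sectorGramG L M β (bgmFatMultiplier L M klE0 β (nambuXiCT L μ (klFlowFrameU L M β U μ n)) (n - 2)) (fun ks => ((klScale klE0 (n - 1) - klScale klE0 n : ℝ) : ℂ) * klE5DerivLineSym L M β μ (klFlowFrameU L M β U μ n) (n - 1) (klE5Kappa L M β U μ (klFlowFrameU L M β U μ n) (n - 1)) Λ ks) Y‖ ≤ κ₀) ∧
          (∀ ks : FreqMomentum L M × Fin 2, ‖klE5SliceSym L M β μ (klFlowFrameU L M β U μ n) (n - 1) (klScale klE0 n) ks * (klE5Kappa L M β U μ (klFlowFrameU L M β U μ n) (n - 1)) ks‖ ≤ 1 / 2 ∧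
            ‖klE5SliceSym L M β μ (klFlowFrameU L M β U μ n) (n - 1) Λ ks * (klE5Kappa L M β U μ (klFlowFrameU L M β U μ n) (n - 1)) ks‖ ≤ 1 / 2) ∧
          (∀ m : ℕ, 4 ≤ m → Even m → ∀ Ωe : Fin m → Option (SectorLeg (sectorCount (n - 2) + 4)),
            hubbardSectorKernelNorm L M β (pointAugment (klAnisoFamily L M β μ (klFlowFrameU L M β U μ n) klE0 (n - 2)) (klE5ExtMomenta Qm x y)) (prescribedTuples univ Ωe) (klE5Carrier L M β μ (klFlowFrameU L M β U μ n) (n - 1) (klE5Kappa L M β U μ (klFlowFrameU L M β U μ n) (n - 1)) (klE5Input L M β U μ (klFlowFrameU L M β U μ n) (n - 1)) Λ) ≤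
              C₀ * Θ ^ (m / 2) * (P.Klam * U) ^ (m / 2 - 1) * (2 : ℝ) ^ ((3 * (m / 2) - 5) * (n - 2)) *
                (((2 : ℝ) ^ (n - 2))⁻¹) ^ levelGainExp (levelCount Ωe)) ∧
          (∀ m : ℕ, ¬ Even m → ∀ Ωe : Fin m → Option (SectorLeg (sectorCount (n - 2) + 4)),
            hubbardSectorKernelNorm L M β (pointAugment (klAnisoFamily L M β μ (klFlowFrameU L M β U μ n) klE0 (n - 2)) (klE5ExtMomenta Qm x y)) (prescribedTuples univ Ωe) (klE5Carrier L M β μ (klFlowFrameU L M β U μ n) (n - 1) (klE5Kappa L M β U μ (klFlowFrameU L M β U μ n) (n - 1)) (klE5Input L M β U μ (klFlowFrameU L M β U μ n) (n - 1)) Λ) ≤ 0) ∧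
          (κ₀ ^ 2 + 8 * Cκ * (klE0 * ((8 : ℝ) ^ (n - 2))⁻¹)) * Θ * (P.Klam * U) * (8 : ℝ) ^ (n - 2) ≤ 1 / 2 ∧
          α ≤ (klScale klE0 (n - 1) - klScale klE0 n) * (Cα * (imagTimeWeight β M)⁻¹ * (16 : ℝ) ^ n / klE0 ^ 2))
    (h12 : ∃ u : EngConsts → ℝ → ℝ, (∀ Q cc, 0 < u Q cc) ∧
        ∀ G : GeoConsts, G.WF → ∀ Q : EngConsts, (klEngQ7 P R).IsRaiseOf Q →
        ∀ cc : ℝ, 0 < cc → cc ≤ klEngC₃6 P R →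
        ∀ μ ∈ klWindowC, ∀ U : ℝ, 0 < U → U ≤ klEngU₀10 P R cc → U ≤ u Q cc →
        ∀ β : ℝ, klBetaMin ≤ β → β ≤ Real.exp (cc / U ^ 2) →
        ∀ (L M : ℕ) [NeZero L] [NeZero M], klEngL₄ P R β U ≤ L → klEngM₃ β U L ≤ M →
        ∀ n : ℕ, 1 ≤ n → n ≤ nScales β + 1 → IsKLRegime U cc (-(n : ℤ)) →
        HistP klPredsV17F2 L M G P Q R β U μ 0 n →
        FrameOK R U (nScales β) μ (klFlowFrameU L M β U μ n) →
        (∀ j ≤ n, LevelsUExportMixedAt L M (klCU2 P R (klEngQ7 P R)) P β U μ j) →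
        ∀ Λ ∈ Set.Icc (klScale klE0 n) (klScale klE0 (n - 1)), ∀ Qm : TorusSite 2 L,
        ∀ x y : TorusSite 2 L × MatsubaraIdx M, x.1 ∈ klBall L μ 0 → y.1 ∈ klBall L μ 0 →
        n ≤ 2 →
        ∃ (α κ₀ δ κ₁ x' A : ℝ) (Nf Ne : ℕ → ℕ → ℝ), 0 ≤ α ∧ 0 ≤ κ₀ ∧ 0 ≤ δ ∧ 0 ≤ κ₁ ∧
          (∀ X, ∑ Y, ‖((sectorSubMatrix L M β (trivialMultiplier L M)).transpose *
            normalCovariance L M (fun ks => ((klScale klE0 (n - 1) - klScale klE0 n : ℝ) : ℂ) * klE5DerivLineSym L M β μ (klFlowFrameU L M β U μ n) (n - 1) (klE5Kappa L M β U μ (klFlowFrameU L M β U μ n) (n - 1)) Λ ks) *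
            sectorSubMatrix L M β (trivialMultiplier L M)) X Y‖ ≤ α) ∧
          (∀ Y, ∑ X, ‖((sectorSubMatrix L M β (trivialMultiplier L M)).transpose *
            normalCovariance L M (fun ks => ((klScale klE0 (n - 1) - klScale klE0 n : ℝ) : ℂ) * klE5DerivLineSym L M β μ (klFlowFrameU L M β U μ n) (n - 1) (klE5Kappa L M β U μ (klFlowFrameU L M β U μ n) (n - 1)) Λ ks) *
            sectorSubMatrix L M β (trivialMultiplier L M)) X Y‖ ≤ α) ∧
          (∀ Y : SpaceTimeIdx L M × SectorLeg 1, Y.2.2 = 0 →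
            ‖sectorGramF L M β (trivialMultiplier L M) (fun ks => ((klScale klE0 (n - 1) - klScale klE0 n : ℝ) : ℂ) * klE5DerivLineSym L M β μ (klFlowFrameU L M β U μ n) (n - 1) (klE5Kappa L M β U μ (klFlowFrameU L M β U μ n) (n - 1)) Λ ks) Y‖ ≤ κ₀) ∧
          (∀ Y : SpaceTimeIdx L M × SectorLeg 1, Y.2.2 = 1 →
            ‖sectorGramG L M β (trivialMultiplier L M) (fun ks => ((klScale klE0 (n - 1) - klScale klE0 n : ℝ) : ℂ) * klE5DerivLineSym L M β μ (klFlowFrameU L M β U μ n) (n - 1) (klE5Kappa L M β U μ (klFlowFrameU L M β U μ n) (n - 1)) Λ ks) Y‖ ≤ κ₀) ∧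
          (∀ X Y, ‖((sectorSubMatrix L M β (trivialMultiplier L M)).transpose * normalCovariance L M (klE5SoftLineSym L M β μ (klFlowFrameU L M β U μ n) (n - 1) (klE5Kappa L M β U μ (klFlowFrameU L M β U μ n) (n - 1)) Λ) *
            sectorSubMatrix L M β (trivialMultiplier L M)) X Y‖ ≤ δ) ∧
          (∀ Y : SpaceTimeIdx L M × SectorLeg 1, Y.2.2 = 0 → ‖sectorGramF L M β (trivialMultiplier L M) (klE5SoftLineSym L M β μ (klFlowFrameU L M β U μ n) (n - 1) (klE5Kappa L M β U μ (klFlowFrameU L M β U μ n) (n - 1)) Λ) Y‖ ≤ κ₁) ∧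
          (∀ Y : SpaceTimeIdx L M × SectorLeg 1, Y.2.2 = 1 → ‖sectorGramG L M β (trivialMultiplier L M) (klE5SoftLineSym L M β μ (klFlowFrameU L M β U μ n) (n - 1) (klE5Kappa L M β U μ (klFlowFrameU L M β U μ n) (n - 1)) Λ) Y‖ ≤ κ₁) ∧
          (∀ k q, 0 ≤ Ne k q) ∧
          (∀ k ∈ Icc 3 (Fintype.card (HubbardFieldIdx L M × Fin 2) + 2), ∀ q ≤ 4, ∀ σ : Fin q → SectorLeg 1,
            hubbardSectorKernelNorm L M β (trivialMultiplier L M) (prescribedTuples univ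
              (Fin.append (fun _ : Fin k => (none : Option (SectorLeg 1))) (fun j => some (σ j)))) (klE5Carrier L M β μ (klFlowFrameU L M β U μ n) (n - 1) (klE5Kappa L M β U μ (klFlowFrameU L M β U μ n) (n - 1)) (klE5Input L M β U μ (klFlowFrameU L M β U μ n) (n - 1)) Λ) ≤ Nf k q) ∧
          (∀ k ∈ Icc 3 (Fintype.card (HubbardFieldIdx L M × Fin 2) + 2), ∀ q ≤ 4, ∀ (τ : Fin 3 → SectorLeg 1) (σ : Fin q → SectorLeg 1),
            hubbardSectorKernelNorm L M β (trivialMultiplier L M) (prescribedTuples univ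
              (Fin.append (fun i : Fin k => if h : (i : ℕ) < 3 then some (τ ⟨i, h⟩) else none) (fun j => some (σ j))))
              (klE5Carrier L M β μ (klFlowFrameU L M β U μ n) (n - 1) (klE5Kappa L M β U μ (klFlowFrameU L M β U μ n) (n - 1)) (klE5Input L M β U μ (klFlowFrameU L M β U μ n) (n - 1)) Λ) ≤ Ne k q) ∧
          0 ≤ x' ∧ x' ≤ 1 / 2 ∧ 0 ≤ A ∧
          (∀ q ∈ Icc 1 4, ∀ k ∈ Icc 3 (Fintype.card (HubbardFieldIdx L M × Fin 2) + 2),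
            (κ₀ ^ 2 + κ₁ ^ 2) ^ (k - 3) * ((imagTimeWeight β M * Nf k q) * (imagTimeWeight β M * Ne k (4 - q))) ≤ x' ^ (k - 3) * A) ∧
          α ≤ (klScale klE0 (n - 1) - klScale klE0 n) * (Cα * (imagTimeWeight β M)⁻¹ * (16 : ℝ) ^ n / klE0 ^ 2) ∧
          δ ≤ Cδ * klE0 * ((8 : ℝ) ^ n)⁻¹ ∧ A ≤ CA * imagTimeWeight β M ^ 2 * (P.Klam * U) ^ 3 * (8 : ℝ) ^ n) :
    ∃ e : ℝ × (EngConsts → ℝ → ℝ), IsE5Pkg2 e ∧ E5ShareStep2 P R e.1 e.2 := by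
  have hCA0 : 0 ≤ CA := le_trans (by positivity) hCA
  refine exists_e5Pkg2_of_stepDataL1 P R (Cα := Cα) (Cδ := Cδ) (CA := CA) hP hR hCα hCA0 (fun Cκ hCκ => ?_) h12
  obtain ⟨u, hu, h⟩ := h3 Cκ hCκ
  refine ⟨u, hu, ?_⟩
  intro G hG Q hQ cc hcc hcc3 μ hμ U hU hU10 hUu β hβ hβc L M _ _ hL hM n hn hnN hreg hH hF hX Λ hΛ Qm x y hx hy h3n
  obtain ⟨α, κ₀, hα, hκ₀, hrow, hcol, hκF₀, hκG₀, hsmall, hlaw, hodd, hsm, hαs⟩ :=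
    h G hG Q hQ cc hcc hcc3 μ hμ U hU hU10 hUu β hβ hβc L M hL hM n hn hnN hreg hH hF hX Λ hΛ Qm x y hx hy h3n
  have hg : 0 ≤ P.Klam * U := mul_nonneg hKlam hU.le
  have hκs : 0 ≤ κ₀ ^ 2 + 8 * Cκ * (klE0 * ((8 : ℝ) ^ (n - 2))⁻¹) := by
    have : (0 : ℝ) < klE0 := by norm_num [klE0]
    positivity
  obtain ⟨Nf, Ne, x', A, hNe0, hNf, hNe, hx0, hx1, hA, henv, hAs⟩ :=
    klE5_vertexPackage_of_levelLaw β (pointAugment (klAnisoFamily L M β μ (klFlowFrameU L M β U μ n) klE0 (n - 2)) (klE5ExtMomenta Qm x y))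
      (klE5Carrier L M β μ (klFlowFrameU L M β U μ n) (n - 1) (klE5Kappa L M β U μ (klFlowFrameU L M β U μ n) (n - 1)) (klE5Input L M β U μ (klFlowFrameU L M β U μ n) (n - 1)) Λ) (show 2 ≤ n by omega) hg hC₀ hΘ hκs hlaw hodd hsm
  refine ⟨α, κ₀, x', A, Nf, Ne, hα, hκ₀, hrow, hcol, hκF₀, hκG₀, hsmall, hNe0, hNf, hNe, hx0, hx1, hA, henv, hαs, hAs.trans ?_⟩
  exact mul_le_mul_of_nonneg_right (mul_le_mul_of_nonneg_right (mul_le_mul_of_nonneg_right hCA (sq_nonneg _)) (pow_nonneg hg 3)) (by positivity)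

/-- **Hence the successor step for the DEFERRED pair** from the law-level inputs. [cite: BenfattoGiulianiMastropietro2006, Lemma 2.5 (2.98)] -/
theorem e5ShareStep2_klE5Raise2_of_stepDataLaw (hP : P.WF) (hR : R.WF2) (hCα : 0 ≤ Cα) (hC₀ : 0 ≤ C₀) (hΘ : 1 ≤ Θ) (hCA : C₀ ^ 2 * Θ ^ 5 / 64 ≤ CA)
    (hKlam : 0 ≤ P.Klam)
    (h3 : ∀ Cκ : ℝ, 0 < Cκ → ∃ u : EngConsts → ℝ → ℝ, (∀ Q cc, 0 < u Q cc) ∧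
        ∀ G : GeoConsts, G.WF → ∀ Q : EngConsts, (klEngQ7 P R).IsRaiseOf Q →
        ∀ cc : ℝ, 0 < cc → cc ≤ klEngC₃6 P R →
        ∀ μ ∈ klWindowC, ∀ U : ℝ, 0 < U → U ≤ klEngU₀10 P R cc → U ≤ u Q cc →
        ∀ β : ℝ, klBetaMin ≤ β → β ≤ Real.exp (cc / U ^ 2) →
        ∀ (L M : ℕ) [NeZero L] [NeZero M], klEngL₄ P R β U ≤ L → klEngM₃ β U L ≤ M →
        ∀ n : ℕ, 1 ≤ n → n ≤ nScales β + 1 → IsKLRegime U cc (-(n : ℤ)) →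
        HistP klPredsV17F2 L M G P Q R β U μ 0 n →
        FrameOK R U (nScales β) μ (klFlowFrameU L M β U μ n) →
        (∀ j ≤ n, LevelsUExportMixedAt L M (klCU2 P R (klEngQ7 P R)) P β U μ j) →
        ∀ Λ ∈ Set.Icc (klScale klE0 n) (klScale klE0 (n - 1)), ∀ Qm : TorusSite 2 L,
        ∀ x y : TorusSite 2 L × MatsubaraIdx M, x.1 ∈ klBall L μ 0 → y.1 ∈ klBall L μ 0 →
        3 ≤ n →
        ∃ (α κ₀ : ℝ), 0 ≤ α ∧ 0 ≤ κ₀ ∧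
          (∀ X, ∑ Y, ‖((sectorSubMatrix L M β (bgmFatMultiplier L M klE0 β (nambuXiCT L μ (klFlowFrameU L M β U μ n)) (n - 2))).transpose *
            normalCovariance L M (fun ks => ((klScale klE0 (n - 1) - klScale klE0 n : ℝ) : ℂ) * klE5DerivLineSym L M β μ (klFlowFrameU L M β U μ n) (n - 1) (klE5Kappa L M β U μ (klFlowFrameU L M β U μ n) (n - 1)) Λ ks) *
            sectorSubMatrix L M β (bgmFatMultiplier L M klE0 β (nambuXiCT L μ (klFlowFrameU L M β U μ n)) (n - 2))) X Y‖ ≤ α) ∧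
          (∀ Y, ∑ X, ‖((sectorSubMatrix L M β (bgmFatMultiplier L M klE0 β (nambuXiCT L μ (klFlowFrameU L M β U μ n)) (n - 2))).transpose *
            normalCovariance L M (fun ks => ((klScale klE0 (n - 1) - klScale klE0 n : ℝ) : ℂ) * klE5DerivLineSym L M β μ (klFlowFrameU L M β U μ n) (n - 1) (klE5Kappa L M β U μ (klFlowFrameU L M β U μ n) (n - 1)) Λ ks) *
            sectorSubMatrix L M β (bgmFatMultiplier L M klE0 β (nambuXiCT L μ (klFlowFrameU L M β U μ n)) (n - 2))) X Y‖ ≤ α) ∧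
          (∀ Y : SpaceTimeIdx L M × SectorLeg (sectorCount (n - 2)), Y.2.2 = 0 →
            ‖sectorGramF L M β (bgmFatMultiplier L M klE0 β (nambuXiCT L μ (klFlowFrameU L M β U μ n)) (n - 2)) (fun ks => ((klScale klE0 (n - 1) - klScale klE0 n : ℝ) : ℂ) * klE5DerivLineSym L M β μ (klFlowFrameU L M β U μ n) (n - 1) (klE5Kappa L M β U μ (klFlowFrameU L M β U μ n) (n - 1)) Λ ks) Y‖ ≤ κ₀) ∧
          (∀ Y : SpaceTimeIdx L M × SectorLeg (sectorCount (n - 2)), Y.2.2 = 1 →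
            ‖sectorGramG L M β (bgmFatMultiplier L M klE0 β (nambuXiCT L μ (klFlowFrameU L M β U μ n)) (n - 2)) (fun ks => ((klScale klE0 (n - 1) - klScale klE0 n : ℝ) : ℂ) * klE5DerivLineSym L M β μ (klFlowFrameU L M β U μ n) (n - 1) (klE5Kappa L M β U μ (klFlowFrameU L M β U μ n) (n - 1)) Λ ks) Y‖ ≤ κ₀) ∧
          (∀ ks : FreqMomentum L M × Fin 2, ‖klE5SliceSym L M β μ (klFlowFrameU L M β U μ n) (n - 1) (klScale klE0 n) ks * (klE5Kappa L M β U μ (klFlowFrameU L M β U μ n) (n - 1)) ks‖ ≤ 1 / 2 ∧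
            ‖klE5SliceSym L M β μ (klFlowFrameU L M β U μ n) (n - 1) Λ ks * (klE5Kappa L M β U μ (klFlowFrameU L M β U μ n) (n - 1)) ks‖ ≤ 1 / 2) ∧
          (∀ m : ℕ, 4 ≤ m → Even m → ∀ Ωe : Fin m → Option (SectorLeg (sectorCount (n - 2) + 4)),
            hubbardSectorKernelNorm L M β (pointAugment (klAnisoFamily L M β μ (klFlowFrameU L M β U μ n) klE0 (n - 2)) (klE5ExtMomenta Qm x y)) (prescribedTuples univ Ωe) (klE5Carrier L M β μ (klFlowFrameU L M β U μ n) (n - 1) (klE5Kappa L M β U μ (klFlowFrameU L M β U μ n) (n - 1)) (klE5Input L M β U μ (klFlowFrameU L M β U μ n) (n - 1)) Λ) ≤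
              C₀ * Θ ^ (m / 2) * (P.Klam * U) ^ (m / 2 - 1) * (2 : ℝ) ^ ((3 * (m / 2) - 5) * (n - 2)) *
                (((2 : ℝ) ^ (n - 2))⁻¹) ^ levelGainExp (levelCount Ωe)) ∧
          (∀ m : ℕ, ¬ Even m → ∀ Ωe : Fin m → Option (SectorLeg (sectorCount (n - 2) + 4)),
            hubbardSectorKernelNorm L M β (pointAugment (klAnisoFamily L M β μ (klFlowFrameU L M β U μ n) klE0 (n - 2)) (klE5ExtMomenta Qm x y)) (prescribedTuples univ Ωe) (klE5Carrier L M β μ (klFlowFrameU L M β U μ n) (n - 1) (klE5Kappa L M β U μ (klFlowFrameU L M β U μ n) (n - 1)) (klE5Input L M β U μ (klFlowFrameU L M β U μ n) (n - 1)) Λ) ≤ 0) ∧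
          (κ₀ ^ 2 + 8 * Cκ * (klE0 * ((8 : ℝ) ^ (n - 2))⁻¹)) * Θ * (P.Klam * U) * (8 : ℝ) ^ (n - 2) ≤ 1 / 2 ∧
          α ≤ (klScale klE0 (n - 1) - klScale klE0 n) * (Cα * (imagTimeWeight β M)⁻¹ * (16 : ℝ) ^ n / klE0 ^ 2))
    (h12 : ∃ u : EngConsts → ℝ → ℝ, (∀ Q cc, 0 < u Q cc) ∧
        ∀ G : GeoConsts, G.WF → ∀ Q : EngConsts, (klEngQ7 P R).IsRaiseOf Q →
        ∀ cc : ℝ, 0 < cc → cc ≤ klEngC₃6 P R →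
        ∀ μ ∈ klWindowC, ∀ U : ℝ, 0 < U → U ≤ klEngU₀10 P R cc → U ≤ u Q cc →
        ∀ β : ℝ, klBetaMin ≤ β → β ≤ Real.exp (cc / U ^ 2) →
        ∀ (L M : ℕ) [NeZero L] [NeZero M], klEngL₄ P R β U ≤ L → klEngM₃ β U L ≤ M →
        ∀ n : ℕ, 1 ≤ n → n ≤ nScales β + 1 → IsKLRegime U cc (-(n : ℤ)) →
        HistP klPredsV17F2 L M G P Q R β U μ 0 n →
        FrameOK R U (nScales β) μ (klFlowFrameU L M β U μ n) →
        (∀ j ≤ n, LevelsUExportMixedAt L M (klCU2 P R (klEngQ7 P R)) P β U μ j) →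
        ∀ Λ ∈ Set.Icc (klScale klE0 n) (klScale klE0 (n - 1)), ∀ Qm : TorusSite 2 L,
        ∀ x y : TorusSite 2 L × MatsubaraIdx M, x.1 ∈ klBall L μ 0 → y.1 ∈ klBall L μ 0 →
        n ≤ 2 →
        ∃ (α κ₀ δ κ₁ x' A : ℝ) (Nf Ne : ℕ → ℕ → ℝ), 0 ≤ α ∧ 0 ≤ κ₀ ∧ 0 ≤ δ ∧ 0 ≤ κ₁ ∧
          (∀ X, ∑ Y, ‖((sectorSubMatrix L M β (trivialMultiplier L M)).transpose *
            normalCovariance L M (fun ks => ((klScale klE0 (n - 1) - klScale klE0 n : ℝ) : ℂ) * klE5DerivLineSym L M β μ (klFlowFrameU L M β U μ n) (n - 1) (klE5Kappa L M β U μ (klFlowFrameU L M β U μ n) (n - 1)) Λ ks) *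
            sectorSubMatrix L M β (trivialMultiplier L M)) X Y‖ ≤ α) ∧
          (∀ Y, ∑ X, ‖((sectorSubMatrix L M β (trivialMultiplier L M)).transpose *
            normalCovariance L M (fun ks => ((klScale klE0 (n - 1) - klScale klE0 n : ℝ) : ℂ) * klE5DerivLineSym L M β μ (klFlowFrameU L M β U μ n) (n - 1) (klE5Kappa L M β U μ (klFlowFrameU L M β U μ n) (n - 1)) Λ ks) *
            sectorSubMatrix L M β (trivialMultiplier L M)) X Y‖ ≤ α) ∧
          (∀ Y : SpaceTimeIdx L M × SectorLeg 1, Y.2.2 = 0 →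
            ‖sectorGramF L M β (trivialMultiplier L M) (fun ks => ((klScale klE0 (n - 1) - klScale klE0 n : ℝ) : ℂ) * klE5DerivLineSym L M β μ (klFlowFrameU L M β U μ n) (n - 1) (klE5Kappa L M β U μ (klFlowFrameU L M β U μ n) (n - 1)) Λ ks) Y‖ ≤ κ₀) ∧
          (∀ Y : SpaceTimeIdx L M × SectorLeg 1, Y.2.2 = 1 →
            ‖sectorGramG L M β (trivialMultiplier L M) (fun ks => ((klScale klE0 (n - 1) - klScale klE0 n : ℝ) : ℂ) * klE5DerivLineSym L M β μ (klFlowFrameU L M β U μ n) (n - 1) (klE5Kappa L M β U μ (klFlowFrameU L M β U μ n) (n - 1)) Λ ks) Y‖ ≤ κ₀) ∧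
          (∀ X Y, ‖((sectorSubMatrix L M β (trivialMultiplier L M)).transpose * normalCovariance L M (klE5SoftLineSym L M β μ (klFlowFrameU L M β U μ n) (n - 1) (klE5Kappa L M β U μ (klFlowFrameU L M β U μ n) (n - 1)) Λ) *
            sectorSubMatrix L M β (trivialMultiplier L M)) X Y‖ ≤ δ) ∧
          (∀ Y : SpaceTimeIdx L M × SectorLeg 1, Y.2.2 = 0 → ‖sectorGramF L M β (trivialMultiplier L M) (klE5SoftLineSym L M β μ (klFlowFrameU L M β U μ n) (n - 1) (klE5Kappa L M β U μ (klFlowFrameU L M β U μ n) (n - 1)) Λ) Y‖ ≤ κ₁) ∧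
          (∀ Y : SpaceTimeIdx L M × SectorLeg 1, Y.2.2 = 1 → ‖sectorGramG L M β (trivialMultiplier L M) (klE5SoftLineSym L M β μ (klFlowFrameU L M β U μ n) (n - 1) (klE5Kappa L M β U μ (klFlowFrameU L M β U μ n) (n - 1)) Λ) Y‖ ≤ κ₁) ∧
          (∀ k q, 0 ≤ Ne k q) ∧
          (∀ k ∈ Icc 3 (Fintype.card (HubbardFieldIdx L M × Fin 2) + 2), ∀ q ≤ 4, ∀ σ : Fin q → SectorLeg 1,
            hubbardSectorKernelNorm L M β (trivialMultiplier L M) (prescribedTuples univ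
              (Fin.append (fun _ : Fin k => (none : Option (SectorLeg 1))) (fun j => some (σ j)))) (klE5Carrier L M β μ (klFlowFrameU L M β U μ n) (n - 1) (klE5Kappa L M β U μ (klFlowFrameU L M β U μ n) (n - 1)) (klE5Input L M β U μ (klFlowFrameU L M β U μ n) (n - 1)) Λ) ≤ Nf k q) ∧
          (∀ k ∈ Icc 3 (Fintype.card (HubbardFieldIdx L M × Fin 2) + 2), ∀ q ≤ 4, ∀ (τ : Fin 3 → SectorLeg 1) (σ : Fin q → SectorLeg 1),
            hubbardSectorKernelNorm L M β (trivialMultiplier L M) (prescribedTuples univ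
              (Fin.append (fun i : Fin k => if h : (i : ℕ) < 3 then some (τ ⟨i, h⟩) else none) (fun j => some (σ j))))
              (klE5Carrier L M β μ (klFlowFrameU L M β U μ n) (n - 1) (klE5Kappa L M β U μ (klFlowFrameU L M β U μ n) (n - 1)) (klE5Input L M β U μ (klFlowFrameU L M β U μ n) (n - 1)) Λ) ≤ Ne k q) ∧
          0 ≤ x' ∧ x' ≤ 1 / 2 ∧ 0 ≤ A ∧
          (∀ q ∈ Icc 1 4, ∀ k ∈ Icc 3 (Fintype.card (HubbardFieldIdx L M × Fin 2) + 2),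
            (κ₀ ^ 2 + κ₁ ^ 2) ^ (k - 3) * ((imagTimeWeight β M * Nf k q) * (imagTimeWeight β M * Ne k (4 - q))) ≤ x' ^ (k - 3) * A) ∧
          α ≤ (klScale klE0 (n - 1) - klScale klE0 n) * (Cα * (imagTimeWeight β M)⁻¹ * (16 : ℝ) ^ n / klE0 ^ 2) ∧
          δ ≤ Cδ * klE0 * ((8 : ℝ) ^ n)⁻¹ ∧ A ≤ CA * imagTimeWeight β M ^ 2 * (P.Klam * U) ^ 3 * (8 : ℝ) ^ n) :
    E5ShareStep2 P R (klE5Raise2 P R) (klE5ShareU2 P R) :=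
  e5ShareStep2_klE5Raise2_of_exists (exists_e5Pkg2_of_stepDataLaw P R hP hR hCα hC₀ hΘ hCA hKlam h3 h12)

end Law

end Summit.HubbardSuperconductivity.HubbardSuperconductivity.Theorems.KLRegimeSplit

end
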